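import Summits.HodgeConjecture.CorCM.Census.OcticWeilMixedParts
import Summits.HodgeConjecture.CorCM.OcticWeilOrbitWeilParts
import HarnessLib

/-!
# COR-CM — MIXED products `E × B₁ × B₂ × B'` over one octic CM field `F ⊇ k` (two `(2,2)`-types in general position, one
# `(1,3)`-type): FRAME TRANSFER to the mixed model, and the algebraic lines of pair parts and of the Weil parts of `B₁, B₂`

Cell `pub-hodgecm2` (COR-CM), seat b30 gen 20 (2026-08-22); count-neutral own lane OCTIC-WEIL-ORBIT, part MIXED — the
geometric side of the kernel census `Census/OcticWeilMixed(Parts)`, as far as it is a re-reading of the ORBIT files: the SAME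
four-slot index set `orbitSlots i₀ i₁ = (k, F, F, F)` and model map `toPt₃` (`CorCM/OcticWeilOrbitFrameTransfer.lean`), with
slot `3` now carrying a `(1,3)`-type.  Theorems only; no definition, no `sorry`; the Weil-part lemma displays
`Markman2025_weilClasses_algebraic_abelianFourfold` as a hypothesis.  NOT HERE (the NEXT SIZED ITEM): the SIXFOLD parts
(`Census.OcticWeilMixed.IsSix₃Part`: two curve points + the four labels of `B'` of one sign — the Weil weight of `B' × E × E`,
algebraic given `Markman2025_weilClasses_algebraic_hyperbolicSixfold` by gen 18's `CorCM/OcticCurveFourfoldWeilSixfold/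
WeilParts` re-slotting device) and the assembly `HC(E^a × B₁^m × B₂^n × B'^p)`.

SETTING.  `A₄ 0 = E ⊨ (k; {τ})` (`hΨ`), `A₄ (m+1) ⊨ (F; Φ_m)` read in a frame `e` through the MIXED table:
`s ∈ Φ_m ⟺ (e s).2 = signTabM c 0 m (e s).1` (`hΦ`) — i.e. `Φ_0 = Φ_{I_0}`, `Φ_1 = Φ_{I_1}` (the `(2,2)`-types `{0,1}`, `{0,2}`)
and `Φ_2 = Φ'_c = {e⁻¹(c, true)} ⊔ {e⁻¹(a, false) | a ≠ c}` (the `(1,3)`-type with its one `τ`-member in the pair `c`).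

* §1 `signTabM_zero_permTab`, **`comp_mem_iff_toPt₃_memM`** — a realiser `ρ_r` of the even permutation `permTab r`
  (`CorCM/OcticWeilOrbitFrameTransfer`: `e (ρ_r ∘ s) = (permTab r (e s).1, (e s).2)`, `ρ_r` fixes `τ`) satisfies
  `ρ_r ∘ x ∈ Φ₄ ⟺ toPt₃ x ∈ phiM c r`; hence **`modelBalancedM_of_isGaloisBalancedAlg`**: Galois-balanced weights of every
  product of copies `⨁_j A₄(κ j)` are balanced configurations of the mixed model (`ModelBalancedM c`).
* §2 `typeCount_eq_two_of_frameM` — the slots `m ≠ 2` have `k`-signature `(2,2)`; **`weightClassesAlg_le_algebraicClasses_of_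
  isWeil₃Part_slot`** — a Weil part of slot `m` (any `m` whose type has `k`-signature `(2,2)`) has an algebraic line given
  Markman's fourfold theorem (the ORBIT lemma with the type count of THAT slot only).  Pair parts: the ORBIT lemma
  `weightClassesAlg_le_algebraicClasses_of_isPairPart₃` applies verbatim (same model map).
HONEST FRAMING: nothing about the Hodge conjecture is concluded here; `HC_CM` is not asserted.
[cite: Pohlmann1968, Thm 1] [cite: GaoUllmo2025, Thm 3.1] [cite: Dodson1984, §3.3.2 Theorem] [cite: Markman2025SurveySecant, Thm. 1.2]

## References
* [Pohlmann1968] H. Pohlmann, Ann. of Math. 88 (1968), Thm 1.  [GaoUllmo2025] Z. Gao, E. Ullmo, J. Inst. Math. Jussieu 25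
  (2025), Thm 3.1 (3.2).  [Dodson1984] B. Dodson, Trans. AMS 283 (1984), §3.3.2 Theorem.  [Markman2025SurveySecant]
  E. Markman, arXiv:2509.23403, Thm. 1.2.  [Milne2020HodgeClassesAV] J. S. Milne, arXiv:2010.08857, 1.2 (a), Thm. 1.
  [MoonenZarhin1995Duke] Duke Math. J. 77 (1995), Thm. 2.4.  [Deligne1982HodgeCycles] LNM 900 (1982), §4 Prop. 4.4.
-/

noncomputable section

open CategoryTheory CategoryTheory.Limits NumberField

namespace Summit.HodgeConjecture.CorCM.OcticWeilMixed

open Literature.AlgebraicGeometry Literature.AlgebraicGeometry.Motives Literature.AlgebraicGeometry.HodgeTheory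
open Literature.AlgebraicGeometry.ComplexMultiplication (IsCMTypeRealisation)
open Literature.AlgebraicGeometry.Pohlmann1968
open Literature.AlgebraicTopology.SingularHomology
open Literature.NumberTheory.ComplexMultiplication
open Summit.HodgeConjecture.CorCM.Census.OcticWeilOrbit (Pt₃ permTab signTab IsWeil₃Part)
open Summit.HodgeConjecture.CorCM.Census.OcticWeilMixed (signTabM signTabM_two phiM inl_mem_phiM inr_mem_phiM
  ModelBalancedM)
open Summit.HodgeConjecture.CorCM.OcticWeilOrbit (orbitSlots toPt₃ toPt₃_zero toPt₃_succ toPt₃_injective sigma_cases₃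
  apply_comp_eq_of_realises₃ comp_eq_tau_iff_of_realises₃ weightClassesAlg_weilWeight₄_le_algebraicClasses_of_markman)
open Summit.HodgeConjecture.CorCM.OcticCurveFourfold (comp_eq_conjugate_of_snd_eq_false)
open Summit.HodgeConjecture.CorCM.OcticWeilFourfold (snd_eq_iff_comp_eq)
open Summit.HodgeConjecture.CorCM.CMWeights (weightClassesAlg_comp_le_algebraicClasses_of_injOn)
open Summit.HodgeConjecture.CorCM.DihedralSexticPairCurvePowers (ncard_sep_eq_card_filter)
open Summit.HodgeConjecture.CorCM.DihedralSexticPair (card_filter_equiv_mem)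

open scoped Classical Pointwise

/-! ## §1 Frame transfer to the mixed model -/

section Transfer

variable {I : Type} {Kf : I → Type} [∀ i, Field (Kf i)]
  {i₀ i₁ : I} {e : (Kf i₁ →+* ℂ) ≃ Fin 4 × Bool} {τ : Kf i₀ →+* ℂ}
  (hττ : ComplexEmbedding.conjugate τ ≠ τ) (hk : ∀ σ : Kf i₀ →+* ℂ, σ = τ ∨ σ = ComplexEmbedding.conjugate τ)
  {i : Kf i₀ →+* Kf i₁}
  (he_sign : ∀ s : Kf i₁ →+* ℂ, (e s).2 = true ↔ s.comp i = τ)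
  (he_conj : ∀ s : Kf i₁ →+* ℂ, e (ComplexEmbedding.conjugate s) = ((e s).1, !(e s).2))
  {c : Fin 4} {Φ₄ : ∀ j : Fin 4, CMType (Kf (orbitSlots i₀ i₁ j))}
  (hΦ : ∀ (m : Fin 3) (s : Kf i₁ →+* ℂ), s ∈ (Φ₄ m.succ).1 ↔ (e s).2 = signTabM c 0 m (e s).1)
  (hΨ : ∀ σ : Kf i₀ →+* ℂ, σ ∈ (Φ₄ 0).1 ↔ σ = τ)

/-- The mixed table read through row `0` (the identity permutation): `signTabM c 0 m (permTab r a) = signTabM c r m a`.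
[folklore] -/
theorem signTabM_zero_permTab : ∀ (c : Fin 4) (r : Fin 12) (m : Fin 3) (a : Fin 4),
    signTabM c 0 m (permTab r a) = signTabM c r m a := by
  unfold signTabM Census.OcticWeilMixed.sixTab
  decide +kernel

include he_conj hΦ in
/-- **How a realiser of `permTab r` acts on a fourfold slot of the mixed model**: `ρ ∘ s ∈ Φ_m ⟺ inr (m, e s) ∈ phiM c r`.
[cite: GaoUllmo2025, Thm 3.1 (3.2)] [cite: Dodson1984, §3.1.1] -/
theorem comp_mem_iff_of_realisesM [NumberField (Kf i₁)] [IsCMField (Kf i₁)] (ρ : ℂ ≃+* ℂ) {r : Fin 12}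
    (hρ : ∀ a : Fin 4, (ρ : ℂ →+* ℂ).comp (e.symm (a, true)) = e.symm (permTab r a, true)) (m : Fin 3)
    (s : Kf i₁ →+* ℂ) : (ρ : ℂ →+* ℂ).comp s ∈ (Φ₄ m.succ).1 ↔ (Sum.inr (m, e s) : Pt₃) ∈ phiM c r := by
  rw [hΦ, apply_comp_eq_of_realises₃ he_conj ρ hρ s, inr_mem_phiM, signTabM_zero_permTab]

include hττ hk he_sign he_conj hΦ hΨ in
/-- **Membership read in the frame**: for a realiser `ρ` of `permTab r`, `ρ ∘ x ∈ Φ₄ ↔ toPt₃ x ∈ phiM c r`.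
[cite: GaoUllmo2025, Thm 3.1 (3.2)] -/
theorem comp_mem_iff_toPt₃_memM [NumberField (Kf i₁)] [IsCMField (Kf i₁)] {ρ : ℂ ≃+* ℂ} {r : Fin 12}
    (hρ : ∀ a : Fin 4, (ρ : ℂ →+* ℂ).comp (e.symm (a, true)) = e.symm (permTab r a, true))
    (x : (j : Fin 4) × (Kf (orbitSlots i₀ i₁ j) →+* ℂ)) :
    (ρ : ℂ →+* ℂ).comp x.2 ∈ (Φ₄ x.1).1 ↔ toPt₃ e τ x ∈ phiM c r := by
  rcases sigma_cases₃ x with ⟨σ, rfl⟩ | ⟨m, s, rfl⟩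
  · change (ρ : ℂ →+* ℂ).comp σ ∈ (Φ₄ 0).1 ↔ _
    rw [hΨ, toPt₃_zero, inl_mem_phiM, comp_eq_tau_iff_of_realises₃ hττ hk he_sign ρ hρ σ]
    exact ⟨fun h => decide_eq_true h, fun h => of_decide_eq_true h⟩
  · exact comp_mem_iff_of_realisesM he_conj hΦ ρ hρ m s

variable {N : ℕ} (κ : Fin N → Fin 4)

include hττ hk he_sign he_conj hΦ hΨ in
/-- **FRAME TRANSFER to the mixed model**: an `Aut(ℂ)`-balanced weight of `X = ⨁_j A₄(κ j)` is a balanced configuration of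
`Census/OcticWeilMixed` (`ModelBalancedM c`: the twelve `A₄`-equations) under `v = toPt₃ e τ ∘ P`, for every slot map `κ`,
provided every even permutation of the pairs is realised in `Aut(ℂ)` (`hgal`; from `2`-transitivity by
`OcticWeilOrbit.hgal_of_h2t`). [cite: GaoUllmo2025, Thm 3.1 (3.2)] [cite: Pohlmann1968, Thm 1] [cite: Dodson1984, §3.3.2 Theorem] -/
theorem modelBalancedM_of_isGaloisBalancedAlg [NumberField (Kf i₁)] [IsCMField (Kf i₁)]
    (hgal : ∀ r : Fin 12, ∃ ρ : ℂ ≃+* ℂ,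
      ∀ a : Fin 4, (ρ : ℂ →+* ℂ).comp (e.symm (a, true)) = e.symm (permTab r a, true))
    {S : Finset ((j : Fin N) × (Kf (orbitSlots i₀ i₁ (κ j)) →+* ℂ))}
    (hS : IsGaloisBalancedAlg (K := fun j => Kf (orbitSlots i₀ i₁ (κ j))) (fun j => Φ₄ (κ j)) S) :
    ModelBalancedM c (fun x => toPt₃ e τ ((Sigma.map κ (fun _ => id) :
      ((j : Fin N) × (Kf (orbitSlots i₀ i₁ (κ j)) →+* ℂ)) → ((m : Fin 4) × (Kf (orbitSlots i₀ i₁ m) →+* ℂ))) x)) S := by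
  intro r
  beta_reduce
  obtain ⟨ρ, hρ⟩ := hgal r
  have h := hS ρ
  rw [ncard_sep_eq_card_filter, ncard_sep_eq_card_filter] at h
  have key : ∀ x : (j : Fin N) × (Kf (orbitSlots i₀ i₁ (κ j)) →+* ℂ),
      (ρ : ℂ →+* ℂ).comp x.2 ∈ (Φ₄ (κ x.1)).1 ↔ toPt₃ e τ ((Sigma.map κ (fun _ => id) :
        ((j : Fin N) × (Kf (orbitSlots i₀ i₁ (κ j)) →+* ℂ)) → ((m : Fin 4) × (Kf (orbitSlots i₀ i₁ m) →+* ℂ))) x)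
          ∈ phiM c r :=
    fun x => comp_mem_iff_toPt₃_memM hττ hk he_sign he_conj hΦ hΨ hρ ⟨κ x.1, x.2⟩
  rw [Finset.filter_congr fun x _ => key x, Finset.filter_congr fun x _ => (key x).not] at h
  have htot := Finset.card_filter_add_card_filter_not
    (s := S) (fun x => toPt₃ e τ ((Sigma.map κ (fun _ => id) :
        ((j : Fin N) × (Kf (orbitSlots i₀ i₁ (κ j)) →+* ℂ)) → ((m : Fin 4) × (Kf (orbitSlots i₀ i₁ m) →+* ℂ))) x)
          ∈ phiM c r)
  omega

end Transfer

/-! ## §2 Type counts of the `(2,2)`-slots; Weil parts slot by slot -/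

section Parts

variable {I : Type} {Kf : I → Type} [∀ i, Field (Kf i)] [∀ i, NumberField (Kf i)] [∀ i, IsCMField (Kf i)]
  {i₀ i₁ : I} {N : ℕ} (κ : Fin N → Fin 4) {e : (Kf i₁ →+* ℂ) ≃ Fin 4 × Bool} {τ : Kf i₀ →+* ℂ} {i : Kf i₀ →+* Kf i₁}
  {A₄ : Fin 4 → AbelianVariety ℂ} {Φ₄ : ∀ j : Fin 4, CMType (Kf (orbitSlots i₀ i₁ j))}
  {ι₄ : ∀ j, 𝓞 (Kf (orbitSlots i₀ i₁ j)) →+* End (A₄ j)}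
  {θ₄ : ∀ j, Kf (orbitSlots i₀ i₁ j) →+* Module.End ℂ (complexBetti (A₄ j).X 1)}

omit [∀ i, NumberField (Kf i)] [∀ i, IsCMField (Kf i)] in
/-- On the slots `m ≠ 2` the mixed table is the ORBIT table: `signTabM c 0 m a = signTab 0 m a`. [folklore] -/
theorem signTabM_zero_of_ne_two {c : Fin 4} {m : Fin 3} (hm : m ≠ 2) (a : Fin 4) : signTabM c 0 m a = signTab 0 m a := by
  unfold signTabM; rw [if_neg hm]

omit [∀ i, IsCMField (Kf i)] in
/-- **The type count of the `(2,2)`-slots of the mixed model**: for `m ≠ 2` and `s ∈ Φ ⟺ (e s).2 = signTabM c 0 m (e s).1`,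
every embedding `τ'` of `k` has `#{s ∈ Φ | s ∘ i = τ'} = 2`. [cite: Deligne1982HodgeCycles, §4 Prop. 4.4] -/
theorem typeCount_eq_two_of_frameM [∀ i, IsCMField (Kf i)] (h2 : Module.finrank ℚ (Kf i₀) = 2)
    (he_sign : ∀ s : Kf i₁ →+* ℂ, (e s).2 = true ↔ s.comp i = τ) {c : Fin 4} {m : Fin 3} (hm : m ≠ 2)
    {Φ : CMType (Kf i₁)} (hΦ : ∀ s : Kf i₁ →+* ℂ, s ∈ Φ.1 ↔ (e s).2 = signTabM c 0 m (e s).1) (τ' : Kf i₀ →+* ℂ) :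
    (Finset.univ.filter fun s : Kf i₁ →+* ℂ => s.comp i = τ' ∧ s ∈ Φ.1).card = 2 :=
  OcticWeilOrbit.typeCount_eq_two_of_frame₃ h2 he_sign m (fun s => by rw [hΦ, signTabM_zero_of_ne_two hm]) τ'

/-- **A Weil part of slot `m` has an algebraic line, GIVEN Markman's fourfold theorem** — for ANY slot `m` whose type has
`k`-signature `(2,2)` (the ORBIT lemma `weightClassesAlg_le_algebraicClasses_of_isWeil₃Part` asks the count for all three
slots; here only the count of slot `m` is used, so that slot `2` may carry a `(1,3)`-type).
[cite: Milne2020HodgeClassesAV, 1.2 (a) and Thm. 1] [cite: Markman2025SurveySecant, Thm. 1.2] -/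
theorem weightClassesAlg_le_algebraicClasses_of_isWeil₃Part_slot (hW4 : Markman2025_weilClasses_algebraic_abelianFourfold)
    (h8 : Module.finrank ℚ (Kf i₁) = 8) (h2 : Module.finrank ℚ (Kf i₀) = 2)
    (hττ : ComplexEmbedding.conjugate τ ≠ τ) (hk : ∀ σ : Kf i₀ →+* ℂ, σ = τ ∨ σ = ComplexEmbedding.conjugate τ)
    (he_sign : ∀ s : Kf i₁ →+* ℂ, (e s).2 = true ↔ s.comp i = τ)
    (hA : ∀ j, IsCMTypeRealisation (Φ₄ j) (A₄ j) (ι₄ j) (θ₄ j)) {m : Fin 3}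
    (hcount : ∀ τ' : Kf i₀ →+* ℂ,
      (Finset.univ.filter fun s : Kf i₁ →+* ℂ => s.comp i = τ' ∧ s ∈ (Φ₄ m.succ).1).card = 2)
    {b : Bool} {G : Finset ((j : Fin N) × (Kf (orbitSlots i₀ i₁ (κ j)) →+* ℂ))}
    (hG : IsWeil₃Part (fun x => toPt₃ e τ ((Sigma.map κ (fun _ => id) :
      ((j : Fin N) × (Kf (orbitSlots i₀ i₁ (κ j)) →+* ℂ)) → ((l : Fin 4) × (Kf (orbitSlots i₀ i₁ l) →+* ℂ))) x)) m b G) :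
    G.card = 2 * 2 ∧ weightClassesAlg (fun j => A₄ (κ j)) (fun j => ι₄ (κ j)) (2 * 2) G ≤
      algebraicClasses (⨁ fun j => A₄ (κ j)).X 2 := by
  set P : ((j : Fin N) × (Kf (orbitSlots i₀ i₁ (κ j)) →+* ℂ)) → ((l : Fin 4) × (Kf (orbitSlots i₀ i₁ l) →+* ℂ)) :=
    Sigma.map κ (fun _ => id) with hP
  have hinjv := hG.injOn
  have hPinj : Set.InjOn P ↑G := fun x hx x' hx' h => hinjv hx hx' (by change toPt₃ e τ (P x) = toPt₃ e τ (P x'); rw [h])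
  have hq : G.card = 2 * 2 := by rw [hG.1]
  set τb : Kf i₀ →+* ℂ := if b then τ else ComplexEmbedding.conjugate τ with hτb
  have hGim : (G.image P).image (toPt₃ e τ) =
      (Finset.univ : Finset (Fin 4)).image fun a => (Sum.inr (m, (a, b)) : Pt₃) := by
    rw [Finset.image_image]; exact hG.image_eq
  have himg : G.image P = (Finset.univ.filter fun s : Kf i₁ →+* ℂ => s.comp i = τb).image fun s : Kf i₁ →+* ℂ =>
      (⟨m.succ, s⟩ : (l : Fin 4) × (Kf (orbitSlots i₀ i₁ l) →+* ℂ)) := by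
    ext y
    constructor
    · intro hy
      have hty : toPt₃ e τ y ∈ (Finset.univ : Finset (Fin 4)).image fun a => (Sum.inr (m, (a, b)) : Pt₃) :=
        hGim ▸ Finset.mem_image_of_mem _ hy
      obtain ⟨a, -, ha⟩ := Finset.mem_image.1 hty
      rcases sigma_cases₃ y with ⟨σ, rfl⟩ | ⟨m', s, rfl⟩
      · rw [toPt₃_zero] at ha
        exact absurd ha Sum.inr_ne_inl
      · rw [toPt₃_succ, Sum.inr.injEq, Prod.mk.injEq] at ha
        obtain ⟨rfl, ha⟩ := ha
        refine Finset.mem_image.2 ⟨s, Finset.mem_filter.2 ⟨Finset.mem_univ _, ?_⟩, rfl⟩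
        exact (snd_eq_iff_comp_eq hk hττ he_sign b s).1 (by rw [← ha])
    · intro hy
      obtain ⟨s, hs, rfl⟩ := Finset.mem_image.1 hy
      have hsb : (e s).2 = b := (snd_eq_iff_comp_eq hk hττ he_sign b s).2 (Finset.mem_filter.1 hs).2
      have hmem : (Sum.inr (m, e s) : Pt₃) ∈ (G.image P).image (toPt₃ e τ) := by
        rw [hGim]
        exact Finset.mem_image.2 ⟨(e s).1, Finset.mem_univ _, by rw [← hsb]⟩
      obtain ⟨y, hy', hty⟩ := Finset.mem_image.1 hmem
      have : y = ⟨m.succ, s⟩ := toPt₃_injective hττ hk (by rw [hty, toPt₃_succ])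
      rwa [this] at hy'
  have hYalg := weightClassesAlg_weilWeight₄_le_algebraicClasses_of_markman i m hA hW4 h8 h2 hcount τb
  rw [← himg] at hYalg
  exact ⟨hq, weightClassesAlg_comp_le_algebraicClasses_of_injOn (K := fun l => Kf (orbitSlots i₀ i₁ l)) hA κ hq
    hPinj hYalg⟩

end Parts

end Summit.HodgeConjecture.CorCM.OcticWeilMixed

end
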